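import Summits.MatrixMultiplication.OmegaCensus.LocalUSPOmegaBound

/-!
# ω-census, family (b1): kernel-certified rows — local strong USP instances and their ω-bounds

HONEST FRAMING (pub-omega census; verbatim): lottery ticket; floor = certified bounds/negative ranges.
Census bookkeeping, not progress on `ω` (the tree proves `ω < 2.373`; every bound here is `> 2.5`).

Each theorem below is ONE census row of sub-family (b1-S) certified by the Lean kernel end to end:
`decide` checks that the explicit puzzle is a local strong USP (CKSU 2005 §6.1, tree `IsLocalStrongUSP`),
`decide` checks the integer inequality `m^{3bk} ≤ s^{3b}(m-1)^{ak}`, and `omega_le_div_of_isLocalStrongUSP`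
(tree, from the PROVED CKSU Thm. 33 + Thm. 5.5) turns the pair into `omega ℂ ≤ a/b`.  The puzzle literal appears
only inside the proof term; the row's identity is the theorem name `omega_le_of_localSUSP_w<k>_s<s>` and its
docstring (rows as words over `{1,2,3}`, CKSU symbols; coded `0,1,2` in the term).  The python engine E1
(`code/famb/bounds.py`, integer power comparison + 60-digit libmpdec) gives the same decimal for every row
(table `run/shared/lean/pub/pub-omega/pub-omega-group/FAMILY-B-TABLE.md`).

Row 1 is the positive CONTROL of the sub-family: the `(2,3)` local strong USP `{123, 231}` generates in `Cyc_n^3`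
exactly the two triples `(H₁∖0, H₂∖0, H₃∖0)`, `(H₂∖0, H₃∖0, H₁∖0)` of CKSU 2005 Prop. 28, whose printed consequence is
"ω < 2.93"; the exact optimum of `2(n−1)^ω ≤ n³` is `n = 16`, `ω ≤ log 2048 / log 15 = 2.81553…`.
-/

noncomputable section

open Literature.Computability.AlgebraicComplexity

namespace Summit.MatrixMultiplication.OmegaCensus

/-- Census row (b1-S) `w3_s2` = CKSU 2005 Prop. 28 made exact: the local strong USP `{123, 231}` (width 3,
2 rows) with modulus `m = 16` certifies `ω ≤ 2.816 = 352/125` (integer certificate `16^1125 ≤ 2^375 · 15^1056`) (exact value of the row: `log 2048 / log 15 = 2.815538…`;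
CKSU print "ω < 2.93" for this example). [cite: CohnKleinbergSzegedyUmans2005, Prop. 28 and Thm. 31] -/
theorem omega_le_of_localSUSP_w3_s2 : omega ℂ ≤ 2.816 := by
  have h := omega_le_div_of_isLocalStrongUSP (row := ![![0, 1, 2], ![1, 2, 0]])
    (by unfold IsLocalStrongUSP localStrongUSPPatterns; decide) (by norm_num) (by norm_num)
    (m := 16) (by norm_num) (a := 352) (b := 125) (by norm_num) (by decide +kernel)
  have e : ((352 : ℕ) : ℝ) / ((125 : ℕ) : ℝ) = 2.816 := by norm_num
  rwa [e] at h

end Summit.MatrixMultiplication.OmegaCensus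

end
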